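import Mathlib
import HarnessLib
import Summits.CriticalPhenomena.PercolationContinuityZ3.Theses.PercTreeValue
import Literature.Probability.Percolation.PercolationEvents

/-!
# Sketch — crux-ideate stmt-CriticalPhenomena-7799 (TetrahedronHarrisGap), ideator k=1

First lemmas of the two idea cards (elaboration only; proofs are for the crux-plan stage).
-/

namespace Summit.CriticalPhenomena.PercolationContinuityZ3.Cruxes.TetrahedronHarrisGap.Sketch

open MeasureTheory
open Literature.Probability.Percolation Literature.Probability.LatticeModels

/-- Card `noise-interpolation-crossed-bridges`, first lemma (single-edge duplication step of the
Kalai–Keller–Mossel / Radhakrishnan–Tassion interpolation): resampling ONE edge `e` of the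
configuration seen by `B` lowers `P(A ∩ B)` by exactly `p(1-p)·P(e is pivotal for A and for B)`.
Telescoping over an enumeration of the edges gives
`P(A ∩ B) - P(A)P(B) = p(1-p) Σ_k P(e_k ∈ Piv_A(ω) ∩ Piv_B(ω^{[k-1]}))` (all terms ≥ 0). -/
theorem coPivotal_duplication_step (p : unitInterval)
    {A B : Set (BondConfig (Site 3))} (hA : IsUpperSet A) (hB : IsUpperSet B)
    (hAm : MeasurableSet A) (hBm : MeasurableSet B)
    {e : Sym2 (Site 3)} (he : e ∈ (zdGraph 3).edgeSet) :
    (bondPercolation (zdGraph 3) p).real (A ∩ B)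
      - ((p : ℝ) * (bondPercolation (zdGraph 3) p).real (A ∩ {ω | insert e ω ∈ B})
          + (1 - (p : ℝ)) * (bondPercolation (zdGraph 3) p).real (A ∩ {ω | ω \ {e} ∈ B}))
      = (p : ℝ) * (1 - (p : ℝ)) *
        (bondPercolation (zdGraph 3) p).real {ω | IsPivotal A e ω ∧ IsPivotal B e ω} := by
  sorry

/-- Card `corner-ball-total-covariance`, first lemma (conditional Harris given a bulk field):
for increasing `A`, `B` and the σ-field generated by the configuration on an edge set `K`,
`P(A ∩ B) ≥ E[ P(A | ω ∩ K) · P(B | ω ∩ K) ]`, whence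
`Cov(1_A, 1_B) ≥ Cov(P(A | ω∩K), P(B | ω∩K))` — the Harris gap of the point events is at least
the covariance of the two bulk-conditional connection probabilities. -/
theorem real_inter_ge_integral_condExp_mul (p : unitInterval) (K : Set (Sym2 (Site 3)))
    {A B : Set (BondConfig (Site 3))} (hA : IsUpperSet A) (hB : IsUpperSet B)
    (hAm : MeasurableSet A) (hBm : MeasurableSet B) :
    ∫ ω, ((bondPercolation (zdGraph 3) p)[A.indicator (fun _ => (1 : ℝ)) |
            MeasurableSpace.comap (fun ω : BondConfig (Site 3) => ω ∩ K) inferInstance]) ω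
        * ((bondPercolation (zdGraph 3) p)[B.indicator (fun _ => (1 : ℝ)) |
            MeasurableSpace.comap (fun ω : BondConfig (Site 3) => ω ∩ K) inferInstance]) ω
        ∂(bondPercolation (zdGraph 3) p)
      ≤ (bondPercolation (zdGraph 3) p).real (A ∩ B) := by
  sorry

/-- Sanity: the crux decl is in scope (type-checks by name). -/
example : Prop := Summit.CriticalPhenomena.PercolationContinuityZ3.Theses.PercTreeValue.TetrahedronHarrisGap

end Summit.CriticalPhenomena.PercolationContinuityZ3.Cruxes.TetrahedronHarrisGap.Sketch
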